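import Summits.BirchSwinnertonDyer.BirchSwinnertonDyer.Theorems.UniversalToricDescentDefectTransportWallStep
import HarnessLib

/-!
# Route UniversalToricDescent — ♭T `DefectTransportModThree` (stmt-BirchSwinnertonDyer-26042) REDUCED TO ITS
# ANALYTIC HALF: the conclusion of ♭T at a pair of frames `(𝓛, 𝓛′)` from the `Σ`-depleted analytic identity
# `m + Σ_{v∈Σ} 3^{c_v}·s_v(E) = m′ + Σ_{v∈Σ} 3^{c_v}·s_v(E′)` (+ (iv), Poitou–Tate ×2, base finiteness)

Lead prover bsd-wall-utd-p1 g11 (`--supports` stmt-BirchSwinnertonDyer-26042; sequel of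
`UniversalToricDescentDefectTransportWallStep`). ♭T (act D, conjecture-grade, «replaces 20399/21845 on the
deciding chain») concludes, at an `E`-frame `𝓛` and a twin frame `𝓛′`: generators `g, g′` of
`Ch(E)·R₀⟦T⟧, Ch(E′)·R₀⟦T⟧` and first-unit indices `n, m, n′, m′` of `g, 𝓛, g′, 𝓛′` with `n + m′ = n′ + m`.
This file proves EXACTLY that conclusion from:

* ♭T's own hypotheses at the frame — `Λ`-torsion of `X_{∅,0}(E/K_∞)` (`hT`) and the wall's inclusion
  `(𝓛) ⊆ Ch(E)·R₀⟦T⟧` (`hle`);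
* the ANALYTIC HALF, stated as the hypothesis `hAn` (+ `hi`: `μ(𝓛) = 0`): for the finite bad set
  `Σ = {v ∤ 3 : E_K or E′_K bad}`, the exact indices `c_v` (`κ(D_v) = 3^{c_v}ℤ₃`) and the local exponents
  `s_v(E), s_v(E′)` (`#H¹(kerD κ v, ·[3^∞])[3] = 3^{s_v}`; = Greenberg–Vatsal's `d_v` by
  `natCard_pTorsion_subgroupH1_kerD_eq_pow_ite`, i.e. the multiplicity of the Frobenius eigenvalue `q_v` on
  `E[3]` — the `λ`-invariant of the Euler factor of the `Σ`-depleted `3`-adic `L`-function at `v`):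
  first-unit indices `m, m′` of `𝓛, 𝓛′` with **`m + Σ_{v∈Σ} 3^{c_v}·s_v(E) = m′ + Σ_{v∈Σ} 3^{c_v}·s_v(E′)`**
  — the identity a congruence `𝓛^Σ_E ≡ u·𝓛^Σ_{E′} (mod 𝔪)` of `Σ`-DEPLETED anticyclotomic `L`-functions with
  `μ = 0` yields (`λ(𝓛^Σ) = λ(𝓛) + Σ_v 3^{c_v} d_v`); UNPRINTED at `27 ∣ N` (LINE-STATUS Notes A/B, frames 20928);
* the algebraic half's standing inputs: (iv) `E(ℚ₃)[3] = 0` (false on the 206 split-type classes),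
  Poitou–Tate ×2 (named facts, leaves 20461/20462), base finiteness at `v ∣ 3` for `E` and `E′`.

* **`defectTransport_frames_of_analytic`** — the displayed reduction (`n := λ_alg(E)`, `n′ := λ_alg(E′)` from
  `defectTransport_algebraicHalf_lambda_of_wall`; `n + Σ = n′ + Σ′` and `m + Σ = m′ + Σ′` give `n + m′ = n′ + m`).

So a closer of ♭T BY NAME is: `intro` its binders, then this theorem with `hAn`/`hi` from an analytic item,
`h4` from (iv), `hfin/hfin′` from base-finiteness items, `hPT/hPT2` the facts — ♭T IS its analytic half
modulo those inputs. THEOREMS ONLY; no definition, no named fact, no `sorry`. BSD is not advanced by this file.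
References: [GreenbergVatsal2000] Thm. (1.4), (1.5), §2 (pp. 20–28); [Brink2007] Thm. 2, Cor. 1.
-/

set_option autoImplicit false
-- `…BirchSwinnertonDyer.BirchSwinnertonDyer.Theorems…` is the problem's mandated namespace (D-0017).
set_option linter.dupNamespace false

noncomputable section

open scoped Classical

namespace Summit.BirchSwinnertonDyer.BirchSwinnertonDyer.Theorems.UniversalToricDescentDefectTransport

open Function Field NumberField IsDedekindDomain WeierstrassCurve
open Literature.NumberTheory.GaloisRepresentations Literature.NumberTheory.EllipticCurves
  Literature.NumberTheory.EllipticCurves.GreenbergSelmer Literature.NumberTheory.GaloisCohomology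
  Literature.NumberTheory.EllipticCurves.IwasawaAlgebra Literature.NumberTheory.EllipticCurves.Rank1Residual
  Summit.BirchSwinnertonDyer.Rank1Residual Summit.BirchSwinnertonDyer.Rank1Residual.X11b
  Summit.BirchSwinnertonDyer.Rank1Residual.X11b.Coinv Summit.BirchSwinnertonDyer.Rank1Residual.X11b.AcSelmer
  Summit.BirchSwinnertonDyer.Rank1Residual.X11b.LocBridge Summit.BirchSwinnertonDyer.Rank1Residual.Iwasawa

/-- **♭T at a pair of frames, from its analytic half.** ♭T binders (E of Kodaira class O6 at `3`, mod-`3`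
twin `E′`, Heegner `K` for `N, N′`, anticyclotomic `κ` with generator `γ`, `𝔭′ ∋ 3`), `X_{∅,0}(E)` torsion,
the wall's inclusion `(𝓛) ⊆ Ch(E)·R₀⟦T⟧`, `μ(𝓛) = 0`, the analytic identity `hAn` (see the module docstring),
(iv), Poitou–Tate ×2, base finiteness for `E`, `E′` ⟹ `∃ g g′ n m n′ m′`: `Ch(E)·R₀⟦T⟧ = (g)`,
`Ch(E′)·R₀⟦T⟧ = (g′)`, `profile_n(g)`, `profile_m(𝓛)`, `profile_{n′}(g′)`, `profile_{m′}(𝓛′)`, `n + m′ = n′ + m`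
— the conclusion of `DefectTransportModThree` verbatim. [cite: GreenbergVatsal2000, Thm. (1.4) and (1.5), §2 (pp. 20–28)]
[cite: Brink2007, Thm. 2 and Cor. 1] -/
theorem defectTransport_frames_of_analytic (W W' : WeierstrassCurve ℚ) [W.IsElliptic]
    [W.IsGloballyMinimal] [W'.IsElliptic] [W'.IsGloballyMinimal] {N N' : ℕ} (K : Type) [Field K]
    [NumberField K]
    (hO6 : Additive.ClassO6 W 3) (hN : W.conductorNorm ℤ = N) (hcong : O6.ModPCongruent W' W 3)
    (hN' : W'.conductorNorm ℤ = N') (hK : IsImaginaryQuadratic K)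
    (hHe : SatisfiesHeegnerHypothesis N K) (hHe' : SatisfiesHeegnerHypothesis N' K)
    (κ : ZpExtension K 3) (hκ : κ.IsAnticyclotomic) (γ : absoluteGaloisGroup K)
    [Fact (κ.IsTopGenerator γ)] {𝔭' : HeightOneSpectrum (𝓞 K)} (h𝔭' : ((3 : ℕ) : 𝓞 K) ∈ 𝔭'.asIdeal)
    (hT : Module.IsTorsion (IwasawaAlgebra 3) (XAc (W.baseChange K) 3 κ 𝔭' ∅ γ))
    {L L' : UnrSeries 3}
    (hle : Ideal.span {L} ≤
      (XAc.charIdeal (W.baseChange K) 3 κ 𝔭' ∅ γ).map (PowerSeries.map (Halves.toUnr 3)))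
    (hi : ∃ i : ℕ, ‖((PowerSeries.coeff i L : unrIntegers 3) : ℂ_[3])‖ = 1)
    (hAn : ∀ (T : Finset (HeightOneSpectrum (𝓞 K))) (c s s' : HeightOneSpectrum (𝓞 K) → ℕ),
      (↑T = {v : HeightOneSpectrum (𝓞 K) | ((3 : ℕ) : 𝓞 K) ∉ v.asIdeal ∧
        (¬ (W.baseChange K).HasGoodReductionAt v ∨ ¬ (W'.baseChange K).HasGoodReductionAt v)}) →
      (∀ v ∈ T, (∃ d₀ : decomp (K := K) v, (κ (d₀ : absoluteGaloisGroup K)).toAdd = (3 : ℤ_[3]) ^ c v) ∧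
        (∀ d : decomp (K := K) v, (3 : ℤ_[3]) ^ c v ∣ (κ (d : absoluteGaloisGroup K)).toAdd) ∧
        Nat.card {f : subgroupH1 (kerD κ v) ((W.baseChange K).geomPrimaryTorsion 3) // 3 • f = 0} =
          3 ^ s v ∧
        Nat.card {f : subgroupH1 (kerD κ v) ((W'.baseChange K).geomPrimaryTorsion 3) // 3 • f = 0} =
          3 ^ s' v) →
      ∃ m m' : ℕ,
        ((∀ i < m, ‖((PowerSeries.coeff i L : unrIntegers 3) : ℂ_[3])‖ < 1) ∧
          ‖((PowerSeries.coeff m L : unrIntegers 3) : ℂ_[3])‖ = 1) ∧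
        ((∀ i < m', ‖((PowerSeries.coeff i L' : unrIntegers 3) : ℂ_[3])‖ < 1) ∧
          ‖((PowerSeries.coeff m' L' : unrIntegers 3) : ℂ_[3])‖ = 1) ∧
        m + ∑ v ∈ T, 3 ^ c v * s v = m' + ∑ v ∈ T, 3 ^ c v * s' v)
    (h4 : ∀ R : (W.baseChange ℚ_[3]).toAffine.Point, 3 • R = 0 → R = 0)
    (hPT : poitouTate_selmerStructure_duality K) (hPT2 : poitouTate_sha_tateDual K)
    (hfin : ∀ v : HeightOneSpectrum (𝓞 K), ((3 : ℕ) : 𝓞 K) ∈ v.asIdeal →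
      Finite (selmerAcBase (W.baseChange K) 3 v ∅))
    (hfin' : ∀ v : HeightOneSpectrum (𝓞 K), ((3 : ℕ) : 𝓞 K) ∈ v.asIdeal →
      Finite (selmerAcBase (W'.baseChange K) 3 v ∅)) :
    ∃ (g g' : UnrSeries 3) (n m n' m' : ℕ),
      (XAc.charIdeal (W.baseChange K) 3 κ 𝔭' ∅ γ).map (PowerSeries.map (Halves.toUnr 3)) =
          Ideal.span {g} ∧
        (XAc.charIdeal (W'.baseChange K) 3 κ 𝔭' ∅ γ).map (PowerSeries.map (Halves.toUnr 3)) =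
          Ideal.span {g'} ∧
        ((∀ i < n, ‖((PowerSeries.coeff i g : unrIntegers 3) : ℂ_[3])‖ < 1) ∧
          ‖((PowerSeries.coeff n g : unrIntegers 3) : ℂ_[3])‖ = 1) ∧
        ((∀ i < m, ‖((PowerSeries.coeff i L : unrIntegers 3) : ℂ_[3])‖ < 1) ∧
          ‖((PowerSeries.coeff m L : unrIntegers 3) : ℂ_[3])‖ = 1) ∧
        ((∀ i < n', ‖((PowerSeries.coeff i g' : unrIntegers 3) : ℂ_[3])‖ < 1) ∧
          ‖((PowerSeries.coeff n' g' : unrIntegers 3) : ℂ_[3])‖ = 1) ∧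
        ((∀ i < m', ‖((PowerSeries.coeff i L' : unrIntegers 3) : ℂ_[3])‖ < 1) ∧
          ‖((PowerSeries.coeff m' L' : unrIntegers 3) : ℂ_[3])‖ = 1) ∧
        n + m' = n' + m := by
  obtain ⟨T, c, s, s', hTS, hdata, ⟨g, hg, hglt, hgeq⟩, -, ⟨g', hg', hglt', hgeq'⟩, hsum⟩ :=
    defectTransport_algebraicHalf_lambda_of_wall W W' K hO6 hN hcong hN' hK hHe hHe' κ hκ γ h𝔭' hT hle hi h4
      hPT hPT2 hfin hfin'
  obtain ⟨m, m', hLm, hL'm', hsum'⟩ := hAn T c s s' hTS hdata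
  refine ⟨g, g', _, m, _, m', hg, hg', ⟨hglt, hgeq⟩, hLm, ⟨hglt', hgeq'⟩, hL'm', ?_⟩
  omega

end Summit.BirchSwinnertonDyer.BirchSwinnertonDyer.Theorems.UniversalToricDescentDefectTransport

end
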